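import Summits.NavierStokesRegularity.NavierStokesRegularity.Theorems.RungBlowupCofinal.Negative.SectoralWaveCasimir
import HarnessLib

/-!
# A smooth `m`-fold azimuthal wave is co-band-limited at every level `L < m`
# (route `AngularGalerkinLadder`, crux K1 `RungBlowupCofinal`; line `qlwave` v3, stub 2;
# theorems only)

Bookkeeping for `stmt-NavierStokesRegularity-19959` (K1 of route №8), cell ns-blowup, refuter5
(K5-80), sequel of `MeanWaveFoldRange` (K5-74, the band-limited special case) and
`SectoralWaveCasimir` (K5-75).
Nothing here asserts a Theses declaration; no definition, no named fact. WHAT THIS IS NOT: not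
Navier–Stokes evidence — a representation-theoretic orthogonality statement in the MODEL `NS_L`
vocabulary (`IsBandLimited` / `IsCobandLimited` / `J₃ = angGen 2`); no rung dynamics, no profile is
constructed or excluded.

## Content

**`isCobandLimited_of_wave`**: for `L < m`, a smooth field `F` with `J₃(J₃F) = −m²F` pointwise is
co-band-limited of degree `L`, i.e. `∫⟪F, ψ⟫ = 0` for every compactly supported field `ψ`
band-limited of degree `≤ L`. In the letters of `Cruxes/RungBlowupCofinal/Lines/qlwave.lean` v3 this
is exactly `stub_wave_cobandLimited` (`IsAzimuthalWave m F` unfolds to the displayed hypothesis by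
`Iff.rfl`); the stub-shaped restatement is **`wave_cobandLimited`**.

Proof — no spectral decomposition on spheres, no `θ`-averaging, no Fourier modes: with
`A = ∫⟪F, ψ⟫`,
* skew-adjointness of `J₃` twice (`integral_inner_angGen_eq_neg`) and the wave equation give
  `∫⟪F, J₃^{2j}ψ⟫ = (−m²)^j A` (`integral_inner_iterate_of_wave`);
* the iterated angular Bernstein inequality (K5-74 `integral_norm_sq_angGen_le`, K5-75
  `isBandLimited_angGen`) gives `‖J₃^{2j}ψ‖²_{L²} ≤ (L(L+1))^{2j} ‖ψ‖²_{L²}`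
  (`integral_norm_sq_iterate_angGen_le`), and `supp J₃^{2j}ψ ⊆ supp ψ` (`iterate_angGen_band`);
* localising `F` by a bump equal to `1` on `supp ψ` and a weighted Young inequality
  (`abs_integral_inner_le_young`) with weight `ε = q'^j`, `q' = ½(L(L+1) + m²)`, yield
  `m^{2j} |A| ≤ q'^j C` for every `j`, with `q' < m²` because `L(L+1) < (L+1)² ≤ m²`; hence `A = 0`.
The only input beyond calculus is the Bernstein inequality of the Casimir cut; in particular the
statement needs the integrated picture only through K5-74 (a purely algebraic derivation from the
`so(3)` relations is impossible: on the Verma module of lowest weight `−L−1` the Casimir polynomial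
`∏_{j≤L}(𝒞 − j(j+1))` vanishes while the `J₃`-weights are unbounded). [cite: BullardGellman1954]
-/

noncomputable section

namespace Summit.NavierStokesRegularity.AngularGalerkinLadderWaveCoband

open Set Function MeasureTheory Filter Topology Metric
open scoped ContDiff RealInnerProductSpace
open Literature.Analysis.FluidPDE
open Summit.NavierStokesRegularity.FluidComputer
open Summit.NavierStokesRegularity.FluidComputer.AngularLadder
open Summit.NavierStokesRegularity.AngularGalerkinLadderMeanWaveFoldRange
open Summit.NavierStokesRegularity.AngularGalerkinLadderSectoralWave

variable {F ψ w : EuclideanSpace ℝ (Fin 3) → EuclideanSpace ℝ (Fin 3)} {L m : ℕ}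

/-- The iterates `J₃^k ψ` of a compactly supported band-limited field are band-limited with the same
support bound. [folklore] -/
theorem iterate_angGen_band (hψ : IsBandLimited L ψ) (hψc : HasCompactSupport ψ) (k : ℕ) :
    IsBandLimited L ((angGen 2)^[k] ψ) ∧ HasCompactSupport ((angGen 2)^[k] ψ) ∧
      tsupport ((angGen 2)^[k] ψ) ⊆ tsupport ψ := by
  induction k with
  | zero => exact ⟨hψ, hψc, subset_rfl⟩
  | succ k ih =>
      rw [Function.iterate_succ_apply']
      exact ⟨isBandLimited_angGen ih.1 2, hasCompactSupport_angGen ih.2.1 2,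
        (tsupport_angGen_subset 2 _).trans ih.2.2⟩

/-- **Iterated angular Bernstein inequality**: `∫‖J₃^k ψ‖² ≤ (L(L+1))^k ∫‖ψ‖²`.
[cite: BullardGellman1954] -/
theorem integral_norm_sq_iterate_angGen_le (hψ : IsBandLimited L ψ) (hψc : HasCompactSupport ψ)
    (k : ℕ) :
    ∫ x, ‖((angGen 2)^[k] ψ) x‖ ^ 2 ≤ ((L : ℝ) * ((L : ℝ) + 1)) ^ k * ∫ x, ‖ψ x‖ ^ 2 := by
  induction k with
  | zero => simp
  | succ k ih =>
      have hb := iterate_angGen_band hψ hψc k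
      rw [Function.iterate_succ_apply', pow_succ]
      calc ∫ x, ‖angGen 2 ((angGen 2)^[k] ψ) x‖ ^ 2
          ≤ ((L : ℝ) * ((L : ℝ) + 1)) * ∫ x, ‖((angGen 2)^[k] ψ) x‖ ^ 2 :=
            integral_norm_sq_angGen_le hb.1 hb.2.1 2
        _ ≤ ((L : ℝ) * ((L : ℝ) + 1)) * (((L : ℝ) * ((L : ℝ) + 1)) ^ k * ∫ x, ‖ψ x‖ ^ 2) :=
            mul_le_mul_of_nonneg_left ih (by positivity)
        _ = ((L : ℝ) * ((L : ℝ) + 1)) ^ k * ((L : ℝ) * ((L : ℝ) + 1)) * ∫ x, ‖ψ x‖ ^ 2 := by ring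

/-- **`J₃²` moves across the pairing onto an `m`-fold wave as `−m²`**: for smooth `F` with
`J₃(J₃F) = −m²F` and smooth compactly supported `w`, `∫⟪F, J₃(J₃ w)⟫ = −m² ∫⟪F, w⟫`
(skew-adjointness of `J₃` twice). [folklore] -/
theorem integral_inner_angGen_angGen_of_wave (hF : ContDiff ℝ ∞ F)
    (hwave : ∀ y, angGen 2 (angGen 2 F) y = -(((m : ℝ) ^ 2) • F y)) (hw : ContDiff ℝ ∞ w)
    (hwc : HasCompactSupport w) :
    ∫ x, ⟪F x, angGen 2 (angGen 2 w) x⟫ = -((m : ℝ) ^ 2) * ∫ x, ⟪F x, w x⟫ := by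
  have hF1 : ContDiff ℝ ∞ (angGen 2 F) := contDiff_angGen hF 2
  have hw1 : ContDiff ℝ ∞ (angGen 2 w) := contDiff_angGen hw 2
  have hw1c : HasCompactSupport (angGen 2 w) := hasCompactSupport_angGen hwc 2
  -- `∫⟪F, J₃(J₃w)⟫ = -∫⟪J₃F, J₃w⟫ = ∫⟪J₃(J₃F), w⟫`
  have h1 : ∫ x, ⟪angGen 2 F x, angGen 2 w x⟫ = -∫ x, ⟪F x, angGen 2 (angGen 2 w) x⟫ :=
    integral_inner_angGen_eq_neg hF hw1 hw1c 2
  have h2 : ∫ x, ⟪angGen 2 (angGen 2 F) x, w x⟫ = -∫ x, ⟪angGen 2 F x, angGen 2 w x⟫ :=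
    integral_inner_angGen_eq_neg hF1 hw hwc 2
  have h3 : ∫ x, ⟪F x, angGen 2 (angGen 2 w) x⟫ = ∫ x, ⟪angGen 2 (angGen 2 F) x, w x⟫ := by
    rw [h2, h1, neg_neg]
  rw [h3]
  have e : (fun x => ⟪angGen 2 (angGen 2 F) x, w x⟫) = fun x => -((m : ℝ) ^ 2) * ⟪F x, w x⟫ := by
    funext x; rw [hwave x, inner_neg_left, real_inner_smul_left, neg_mul]
  rw [e, integral_const_mul]

/-- Iterated: `∫⟪F, J₃^{2j} ψ⟫ = (−m²)^j ∫⟪F, ψ⟫`. [folklore] -/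
theorem integral_inner_iterate_of_wave (hF : ContDiff ℝ ∞ F)
    (hwave : ∀ y, angGen 2 (angGen 2 F) y = -(((m : ℝ) ^ 2) • F y)) (hψ : IsBandLimited L ψ)
    (hψc : HasCompactSupport ψ) (j : ℕ) :
    ∫ x, ⟪F x, ((angGen 2)^[2 * j] ψ) x⟫ = (-((m : ℝ) ^ 2)) ^ j * ∫ x, ⟪F x, ψ x⟫ := by
  induction j with
  | zero => simp
  | succ j ih =>
      have hb := iterate_angGen_band hψ hψc (2 * j)
      have e : (angGen 2)^[2 * (j + 1)] ψ = angGen 2 (angGen 2 ((angGen 2)^[2 * j] ψ)) := by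
        rw [show 2 * (j + 1) = (2 * j + 1) + 1 by ring, Function.iterate_succ_apply',
          Function.iterate_succ_apply']
      rw [e, integral_inner_angGen_angGen_of_wave hF hwave hb.1.1 hb.2.1, ih, pow_succ]
      ring

/-- Weighted Young inequality for a pairing of continuous compactly supported fields:
`|∫⟪G, w⟫| ≤ ½(ε ∫‖G‖² + ε⁻¹ ∫‖w‖²)`. [folklore] -/
theorem abs_integral_inner_le_young {G : EuclideanSpace ℝ (Fin 3) → EuclideanSpace ℝ (Fin 3)}
    (hG : Continuous G) (hGc : HasCompactSupport G) (hw : Continuous w) (hwc : HasCompactSupport w)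
    {ε : ℝ} (hε : 0 < ε) :
    |∫ x, ⟪G x, w x⟫| ≤ (ε * (∫ x, ‖G x‖ ^ 2) + ε⁻¹ * (∫ x, ‖w x‖ ^ 2)) / 2 := by
  have hGc2 : HasCompactSupport fun x => ‖G x‖ ^ 2 :=
    hGc.mono' fun x hx => subset_tsupport _ fun h0 => hx (by simp [h0])
  have hwc2 : HasCompactSupport fun x => ‖w x‖ ^ 2 :=
    hwc.mono' fun x hx => subset_tsupport _ fun h0 => hx (by simp [h0])
  have hiG : Integrable fun x => ‖G x‖ ^ 2 :=
    ((hG.norm).pow 2).integrable_of_hasCompactSupport hGc2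
  have hiw : Integrable fun x => ‖w x‖ ^ 2 :=
    ((hw.norm).pow 2).integrable_of_hasCompactSupport hwc2
  have hpt : ∀ x, ‖⟪G x, w x⟫‖ ≤ (ε * ‖G x‖ ^ 2 + ε⁻¹ * ‖w x‖ ^ 2) / 2 := by
    intro x
    have h1 : ‖⟪G x, w x⟫‖ ≤ ‖G x‖ * ‖w x‖ := norm_inner_le_norm _ _
    have h2 : 2 * (‖G x‖ * ‖w x‖) ≤ ε * ‖G x‖ ^ 2 + ε⁻¹ * ‖w x‖ ^ 2 := by
      have h0 : 0 ≤ (ε * ‖G x‖ - ‖w x‖) ^ 2 / ε := div_nonneg (sq_nonneg _) hε.le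
      have e : (ε * ‖G x‖ - ‖w x‖) ^ 2 / ε =
          ε * ‖G x‖ ^ 2 + ε⁻¹ * ‖w x‖ ^ 2 - 2 * (‖G x‖ * ‖w x‖) := by
        field_simp
        ring
      linarith [h0, e]
    linarith
  have hsum : Integrable fun x => (ε * ‖G x‖ ^ 2 + ε⁻¹ * ‖w x‖ ^ 2) / 2 :=
    ((hiG.const_mul ε).add (hiw.const_mul ε⁻¹)).div_const 2
  have h := norm_integral_le_of_norm_le hsum (Eventually.of_forall hpt)
  rw [Real.norm_eq_abs] at h
  refine h.trans (le_of_eq ?_)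
  rw [integral_div, integral_add (hiG.const_mul ε) (hiw.const_mul ε⁻¹), integral_const_mul,
    integral_const_mul]

/-- **A smooth `m`-fold azimuthal wave is co-band-limited at every level `L < m`** (stub 2 v3 of
`Lines/qlwave.lean`, `stub_wave_cobandLimited`, with `IsAzimuthalWave m F` unfolded): for `F` smooth
with `J₃(J₃F) = −m²F` and every compactly supported field `ψ` band-limited of degree `≤ L`,
`∫⟪F, ψ⟫ = 0`. Proof (no spectral decomposition, no `θ`-averaging): by skew-adjointness
`m^{2j} |∫⟪F,ψ⟫| = |∫⟪F, J₃^{2j}ψ⟫|`; by the iterated angular Bernstein inequality (K5-74)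
`‖J₃^{2j}ψ‖_{L²} ≤ (L(L+1))^{j} ‖ψ‖_{L²}`, and `J₃^{2j}ψ` is supported in `supp ψ`, where `F` is
bounded; so `|∫⟪F,ψ⟫| ≤ C (q'/m²)^j` with `L(L+1) < q' < m²`, for every `j` — hence `0`.
[cite: BullardGellman1954] -/
theorem isCobandLimited_of_wave (hLm : L < m) (hF : ContDiff ℝ ∞ F)
    (hwave : ∀ y, angGen 2 (angGen 2 F) y = -(((m : ℝ) ^ 2) • F y)) :
    IsCobandLimited L F := by
  intro ψ hψ hψc
  -- localise `F` to a compactly supported continuous `G` agreeing with `F` on `tsupport ψ`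
  obtain ⟨R, hR⟩ := (hψc.isCompact.isBounded).subset_closedBall (0 : EuclideanSpace ℝ (Fin 3))
  let φ : ContDiffBump (0 : EuclideanSpace ℝ (Fin 3)) :=
    ⟨|R| + 1, |R| + 2, by positivity, by linarith⟩
  set G : EuclideanSpace ℝ (Fin 3) → EuclideanSpace ℝ (Fin 3) := fun x => φ x • F x with hG
  have hGc' : Continuous G := φ.continuous.smul hF.continuous
  have hGc : HasCompactSupport G := φ.hasCompactSupport.smul_right
  have hagree : ∀ v : EuclideanSpace ℝ (Fin 3) → EuclideanSpace ℝ (Fin 3),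
      tsupport v ⊆ tsupport ψ → ∀ x, ⟪F x, v x⟫ = ⟪G x, v x⟫ := by
    intro v hv x
    by_cases hx : x ∈ tsupport ψ
    · have hxR : x ∈ closedBall (0 : EuclideanSpace ℝ (Fin 3)) φ.rIn := by
        have h1 := hR hx
        rw [mem_closedBall, dist_zero_right] at h1 ⊢
        show ‖x‖ ≤ |R| + 1
        linarith [le_abs_self R]
      have h1 : φ x = 1 := φ.one_of_mem_closedBall hxR
      show ⟪F x, v x⟫ = ⟪φ x • F x, v x⟫
      rw [h1, one_smul]
    · have h0 : v x = 0 := image_eq_zero_of_notMem_tsupport fun h => hx (hv h)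
      rw [h0, inner_zero_right, inner_zero_right]
  -- the constants
  have hm : (0 : ℝ) < m := by exact_mod_cast (show 0 < m by omega)
  have hm2 : (0 : ℝ) < (m : ℝ) ^ 2 := by positivity
  have hLm' : (L : ℝ) + 1 ≤ m := by exact_mod_cast Nat.succ_le_of_lt hLm
  set q : ℝ := (L : ℝ) * ((L : ℝ) + 1) with hq
  have hq0 : 0 ≤ q := by positivity
  have hqm : q < (m : ℝ) ^ 2 := by
    have hL0 : (0 : ℝ) ≤ L := Nat.cast_nonneg L
    nlinarith
  set q' : ℝ := (q + (m : ℝ) ^ 2) / 2 with hq'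
  have hq'0 : 0 < q' := by positivity
  have hqq' : q ≤ q' := by linarith
  have hq'm : q' < (m : ℝ) ^ 2 := by linarith
  set I : ℝ := ∫ x, ‖G x‖ ^ 2 with hI
  set P : ℝ := ∫ x, ‖ψ x‖ ^ 2 with hP
  set A : ℝ := ∫ x, ⟪F x, ψ x⟫ with hA
  have hI0 : 0 ≤ I := integral_nonneg fun _ => sq_nonneg _
  have hP0 : 0 ≤ P := integral_nonneg fun _ => sq_nonneg _
  -- the key estimate `(m²)^j |A| ≤ q'^j (I + P)/2`
  have key : ∀ j : ℕ, ((m : ℝ) ^ 2) ^ j * |A| ≤ q' ^ j * ((I + P) / 2) := by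
    intro j
    have hb := iterate_angGen_band hψ hψc (2 * j)
    have h1 : |∫ x, ⟪F x, ((angGen 2)^[2 * j] ψ) x⟫| = ((m : ℝ) ^ 2) ^ j * |A| := by
      rw [integral_inner_iterate_of_wave hF hwave hψ hψc j, abs_mul, abs_pow, abs_neg,
        abs_of_nonneg hm2.le]
    have h2 : ∫ x, ⟪F x, ((angGen 2)^[2 * j] ψ) x⟫ = ∫ x, ⟪G x, ((angGen 2)^[2 * j] ψ) x⟫ :=
      integral_congr_ae (Eventually.of_forall (hagree _ hb.2.2))
    have hwj : ∫ x, ‖((angGen 2)^[2 * j] ψ) x‖ ^ 2 ≤ q ^ (2 * j) * P :=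
      integral_norm_sq_iterate_angGen_le hψ hψc (2 * j)
    have hY := abs_integral_inner_le_young hGc' hGc hb.1.1.continuous hb.2.1 (pow_pos hq'0 j)
    rw [← hI] at hY
    have hjinv : 0 ≤ (q' ^ j)⁻¹ := inv_nonneg.2 (pow_nonneg hq'0.le j)
    have h3 : (q' ^ j)⁻¹ * ∫ x, ‖((angGen 2)^[2 * j] ψ) x‖ ^ 2 ≤ q' ^ j * P := by
      calc (q' ^ j)⁻¹ * ∫ x, ‖((angGen 2)^[2 * j] ψ) x‖ ^ 2
          ≤ (q' ^ j)⁻¹ * (q ^ (2 * j) * P) := mul_le_mul_of_nonneg_left hwj hjinv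
        _ ≤ (q' ^ j)⁻¹ * (q' ^ (2 * j) * P) :=
            mul_le_mul_of_nonneg_left
              (mul_le_mul_of_nonneg_right (pow_le_pow_left₀ hq0 hqq' _) hP0) hjinv
        _ = q' ^ j * P := by
            have hne : q' ^ j ≠ 0 := pow_ne_zero j hq'0.ne'
            rw [pow_mul', sq, ← mul_assoc, ← mul_assoc, inv_mul_cancel₀ hne, one_mul]
    calc ((m : ℝ) ^ 2) ^ j * |A| = |∫ x, ⟪G x, ((angGen 2)^[2 * j] ψ) x⟫| := by rw [← h1, h2]
      _ ≤ (q' ^ j * I + (q' ^ j)⁻¹ * (∫ x, ‖((angGen 2)^[2 * j] ψ) x‖ ^ 2)) / 2 := hY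
      _ ≤ (q' ^ j * I + q' ^ j * P) / 2 := by linarith
      _ = q' ^ j * ((I + P) / 2) := by ring
  -- geometric decay: `|A| ≤ (q'/m²)^j (I + P)/2` for every `j`, ratio `< 1`
  set r : ℝ := q' / (m : ℝ) ^ 2 with hr
  have hr0 : 0 ≤ r := div_nonneg hq'0.le hm2.le
  have hr1 : r < 1 := (div_lt_one hm2).2 hq'm
  have hbound : ∀ j : ℕ, |A| ≤ r ^ j * ((I + P) / 2) := by
    intro j
    have hmj : 0 < ((m : ℝ) ^ 2) ^ j := pow_pos hm2 j
    rw [hr, div_pow, div_mul_eq_mul_div, le_div_iff₀ hmj]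
    linarith [key j]
  have hlim : Tendsto (fun j : ℕ => r ^ j * ((I + P) / 2)) atTop (𝓝 (0 * ((I + P) / 2))) :=
    (tendsto_pow_atTop_nhds_zero_of_lt_one hr0 hr1).mul_const _
  rw [zero_mul] at hlim
  have hA0 : |A| ≤ 0 := ge_of_tendsto' hlim hbound
  exact abs_nonpos_iff.1 hA0

/-- **Stub 2 of `Lines/qlwave.lean` v3 in its own shape** (`IsAzimuthalWave m F` unfolded): every
smooth `m`-fold azimuthal wave is co-band-limited at every level `L < m`.
[cite: BullardGellman1954] -/
theorem wave_cobandLimited :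
    ∀ (L m : ℕ) (F : EuclideanSpace ℝ (Fin 3) → EuclideanSpace ℝ (Fin 3)), L < m → ContDiff ℝ ∞ F →
      (∀ y, angGen 2 (angGen 2 F) y = -(((m : ℝ) ^ 2) • F y)) → IsCobandLimited L F :=
  fun _ _ _ hLm hF hwave => isCobandLimited_of_wave hLm hF hwave

end Summit.NavierStokesRegularity.AngularGalerkinLadderWaveCoband

end
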